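import Summits.BirchSwinnertonDyer.BirchSwinnertonDyer.Theorems.SemiOrdinaryEisensteinDescentShaTwoCochainBridgeLocal
import Literature.NumberTheory.GaloisRepresentations.HomDualShaTwoConnecting
import HarnessLib

/-!
# The Ш²-cochain bridge, instantiation (global data): for cell bsd-schneider's obstruction map `Ψ = shaTwoConnecting` the data
# `h̃, ξ, ξ̃, F, γ̃, c, B` of `…ShaTwoCochainBridgeIdele` EXIST on the canonical presentation and `Ψ h = H²(e⁻¹)[F]`
# (step S2-inst (G) of SHA2-BRIDGE-w3g7)

Route `SemiOrdinaryEisensteinDescent` (BSD), Kolyvagin column, Cassels–Tate lane: print item `CasselsTateLevelInputsFact`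
(stmt-BirchSwinnertonDyer-20191), last input `hPTc`.  Sequel of `…ShaTwoCochainBridgeIdele` (S2a, p634550) and
`…ShaTwoCochainBridgeLocal` (S2b, p635080), whose hypotheses are statements about VALUES of abstract cochains; this file produces
the cochains for the ACTUAL objects of road B — door-c4's canonical presentation `0 → N₁ → P → M → 0` (`presModule₁/₂`,
`presIncl`, `presProj`, `pres_isSES`) and door-c5's idèle class sequence `0 → K̄ˣ → J̄ → C̄ → 0` (`units K`,
`toDGM (ideleBarD K)`, `toDGM (classBarD K)`, `unitsToIdeleI`, `ideleToClassI`; `hom_idele_isSES`, `dual_pres_isSES`) — for an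
ARBITRARY finite `n`-torsion discrete module `ρ`, an equivariant `h : N₁ ⟶ C̄` and a `1`-cocycle `γ` of `M`:

* **`exists_bridgeGlobalData`** — there are `h̃` (a ℤ-linear lift of `h` to `J̄`), the `δ₀`-cocycle `ξ` of `h̃`, a continuous
  lift `ξ̃` of `ξ` to `Hom(P, K̄ˣ)`, the connecting `2`-cocycle `F` of `ξ̃` (valued in `Hom(M, K̄ˣ)`), a continuous lift `γ̃` of `γ`
  to `P` and the connecting `2`-cocycle `c` of `γ̃` (valued in `N₁`), satisfying EXACTLY the hypotheses `hξ, hξt, hF, hγt, hc` of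
  `ShaTwoCochain.dTwo_bridgeCochain`, together with **`shaTwoConnecting ρ n hM h = H²(e⁻¹) [F]`** (`e = tateDualUnitsIso`);
* **`exists_bridgeCochain`** — the idèle `2`-cochain `B(σ,τ) = uJ (ξ̃(σ)(σ γ̃(τ))) + h̃(c(σ,τ))` EXISTS as a continuous map
  (built in the action-free form `σ γ̃(τ) = i c(σ,τ) + γ̃(στ) − γ̃(σ)`).

So S2a's `dTwo_bridgeCochain` / `bridgeCocycle_mem` / `idele_class_of_bridgeCocycle` and S2b's identities apply to THE bridge of
`Ψ h` against `[γ]`.  (The global `2`-cochain `H` with `dH = F ∪ γ` — from `H³(K, μₙ) = 0` at odd prime-power level — and the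
per-place data `η̃_v, φ_v` are the sequel, S2-inst (L).)  Width seat `bsd-wall-soed-p2-w3` g7; `--supports
stmt-BirchSwinnertonDyer-20480`, helper.  THEOREMS ONLY; no case of BSD, Poitou–Tate or Cassels–Tate is proved here.

## References
* [MilneADT2006] J. S. Milne, *Arithmetic Duality Theorems*, 2nd ed. (2006), I §0 (0.8), Thm. 4.10 (a) (proof, p. 58), Lemma 4.13.
* [NeukirchSchmidtWingberg2008] J. Neukirch, A. Schmidt, K. Wingberg, *Cohomology of Number Fields* (2008), (1.3.2).
* [SerreGaloisCohomology1997] J.-P. Serre, *Galois Cohomology* (1997), I §2.2.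
-/

noncomputable section

-- `Summit.<P>.<Sub>` repeats `BirchSwinnertonDyer` by the tree's layout convention (D-0017)
set_option linter.dupNamespace false
set_option autoImplicit false

namespace Summit.BirchSwinnertonDyer.BirchSwinnertonDyer.Theorems.ShaTwoCochain

open CategoryTheory CategoryTheory.Limits NumberField
open Literature.NumberTheory.GaloisRepresentations Literature.NumberTheory.GaloisRepresentations.HomDual
open Literature.Algebra.Homology Literature.Algebra.Homology.DiscreteRep ContRepresentation Field Literature
open Literature.NumberTheory.GaloisRepresentations.DiscreteGaloisModule (units UnitsCarrier)
open Literature.NumberTheory.GaloisRepresentations.IdeleClassBar (classBarD)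
open Literature.NumberTheory.GaloisRepresentations.FreePresentation
open Literature.NumberTheory.GaloisRepresentations.DGMBridge
open scoped ContRepresentation

variable {K : Type} [Field K] [NumberField K]
variable {M : Type} [AddCommGroup M] [TopologicalSpace M] [DiscreteTopology M] [Finite M]
variable (ρ : DiscreteGaloisModule K M) (n : ℕ) (hM : ∀ m : M, n • m = 0)

/-- **The global bridge data exist on the canonical presentation** — see the module docstring.  The six displayed components
and their five defining identities are EXACTLY the hypotheses `ht, ξ, hξ, ξt, hξt, F, hF, γ, γt, hγt, c, hc, hcc` of
`ShaTwoCochain.dTwo_bridgeCochain` (with `i := presIncl ρ`, `p := presProj ρ`, `uJ := unitsToIdeleI K`), and the last conjunct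
identifies the obstruction class: `shaTwoConnecting ρ n hM h = H²(e⁻¹)[F]`.
[cite: MilneADT2006, I Thm. 4.10 (a) (proof, p. 58)][cite: NeukirchSchmidtWingberg2008, (1.3.2)][cite: SerreGaloisCohomology1997, I §2.2] -/
theorem exists_bridgeGlobalData (h : (presentationComplex ρ).X₁ ⟶ classBarD K) (γ : contOneCocycles ρ.toTopRep) :
    haveI := moduleFinite_presModule₁ ρ
    haveI := moduleFinite_presModule₂ ρ
    haveI := absoluteGaloisGroup_compactSpace K
    ∃ (ht : DiscreteRep.HomCarrier (LCarrier (presentationComplex ρ).X₁) (LCarrier (ideleBarD K)))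
      (ξ : C(absoluteGaloisGroup K, DiscreteRep.HomCarrier (LCarrier (presentationComplex ρ).X₁) (UnitsCarrier K)))
      (ξt : C(absoluteGaloisGroup K, DiscreteRep.HomCarrier (LCarrier (presentationComplex ρ).X₂) (UnitsCarrier K)))
      (F : contTwoCocycles (homGaloisModule ρ (units K)).toTopRep)
      (γt : C(absoluteGaloisGroup K, LCarrier (presentationComplex ρ).X₂))
      (c : contTwoCocycles (presModule₁ ρ).toTopRep),
      postcomp (presModule₁ ρ) (toDGM (ideleBarD K)) (toDGM (classBarD K)) (ideleToClassI K) ht =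
          ((homInvariant (presentationComplex ρ).X₁ (classBarD K) h).1 :
            DiscreteRep.HomCarrier (LCarrier (presentationComplex ρ).X₁) (LCarrier (classBarD K))) ∧
      (∀ (σ : absoluteGaloisGroup K) (x : LCarrier (presentationComplex ρ).X₁),
        unitsToIdeleI K ((show _ →ₗ[ℤ] UnitsCarrier K from ξ σ) x) =
          (show _ →ₗ[ℤ] LCarrier (ideleBarD K) from homGaloisModule (presModule₁ ρ) (toDGM (ideleBarD K)) σ ht) x -
            (show _ →ₗ[ℤ] LCarrier (ideleBarD K) from ht) x) ∧
      (∀ (σ : absoluteGaloisGroup K) (x : LCarrier (presentationComplex ρ).X₁),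
        (show _ →ₗ[ℤ] UnitsCarrier K from ξt σ) (presIncl ρ x) = (show _ →ₗ[ℤ] UnitsCarrier K from ξ σ) x) ∧
      (∀ (σ τ : absoluteGaloisGroup K) (y : LCarrier (presentationComplex ρ).X₂),
        (show M →ₗ[ℤ] UnitsCarrier K from F.1 (σ, τ)) (presProj ρ y) =
          (show _ →ₗ[ℤ] UnitsCarrier K from homGaloisModule (presModule₂ ρ) (units K) σ (ξt τ)) y -
            (show _ →ₗ[ℤ] UnitsCarrier K from ξt (σ * τ)) y + (show _ →ₗ[ℤ] UnitsCarrier K from ξt σ) y) ∧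
      (∀ σ : absoluteGaloisGroup K, presProj ρ (γt σ) = γ.1 σ) ∧
      (∀ σ τ : absoluteGaloisGroup K,
        presIncl ρ (c.1 (σ, τ)) = (presModule₂ ρ) σ (γt τ) - γt (σ * τ) + γt σ) ∧
      shaTwoConnecting ρ n hM h = cohomologyMap (tateDualUnitsIso K ρ n hM).inv 2 (twoCocycleClass _ F) := by
  haveI := moduleFinite_presModule₁ ρ
  haveI := moduleFinite_presModule₂ ρ
  haveI := absoluteGaloisGroup_compactSpace K
  -- the lift `h̃` of `h` and its `δ₀`-cocycle `ξ`
  set v := homInvariant (presentationComplex ρ).X₁ (classBarD K) h with hv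
  let ht : DiscreteRep.HomCarrier (LCarrier (presentationComplex ρ).X₁) (LCarrier (ideleBarD K)) :=
    (hom_idele_isSES ρ).lift v.1
  have hht : (homG (presModule₁ ρ) (toDGM (ideleBarD K)) (toDGM (classBarD K)) (ideleToClassI K)).hom ht = v.1 :=
    (hom_idele_isSES ρ).g_lift v.1
  have hht' : (homG (presModule₁ ρ) (toDGM (ideleBarD K)) (toDGM (classBarD K)) (ideleToClassI K)).hom ht ∈
      (homGaloisModule (presModule₁ ρ) (toDGM (classBarD K))).toTopRep.ρ.invariants := by
    rw [hht]; exact v.2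
  let ξ := (hom_idele_isSES ρ).δ₀Cocycle ht hht'
  -- the lift `ξ̃` and the connecting cocycle `F`
  let ξt := (dual_pres_isSES ρ).liftCocycle ξ
  let F := (dual_pres_isSES ρ).connectingCocycle ξt ((dual_pres_isSES ρ).liftCocycle_isLift ξ)
  -- the lift `γ̃` and the connecting cocycle `c`
  let γt := (pres_isSES ρ).liftCocycle γ
  let c := (pres_isSES ρ).connectingCocycle γt ((pres_isSES ρ).liftCocycle_isLift γ)
  refine ⟨ht, ξ.1, ξt, F, γt, c, hht, fun σ x => ?_, fun σ x => ?_, fun σ τ y => ?_, fun σ => ?_, fun σ τ => ?_, ?_⟩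
  · -- `uJ (ξ σ x) = (σ⋆h̃) x − h̃ x`
    have e := (hom_idele_isSES ρ).f_δ₀Cocycle_apply ht hht' σ
    have ex := congrArg (fun Φ : DiscreteRep.HomCarrier (LCarrier (presentationComplex ρ).X₁) (LCarrier (ideleBarD K)) =>
      (show _ →ₗ[ℤ] LCarrier (ideleBarD K) from Φ) x) e
    exact ex
  · -- `ξ̃ σ (i x) = ξ σ x`
    have e := (dual_pres_isSES ρ).g_liftCocycle_apply ξ σ
    exact congrArg (fun Φ : DiscreteRep.HomCarrier (LCarrier (presentationComplex ρ).X₁) (UnitsCarrier K) =>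
      (show _ →ₗ[ℤ] UnitsCarrier K from Φ) x) e
  · -- `F(σ,τ) (p y) = (σ⋆ξ̃τ − ξ̃(στ) + ξ̃σ) y`
    have e := (dual_pres_isSES ρ).f_connectingCocycle_apply ξt ((dual_pres_isSES ρ).liftCocycle_isLift ξ) σ τ
    have ey := congrArg (fun Φ : DiscreteRep.HomCarrier (LCarrier (presentationComplex ρ).X₂) (UnitsCarrier K) =>
      (show _ →ₗ[ℤ] UnitsCarrier K from Φ) y) e
    exact ey
  · exact (pres_isSES ρ).g_liftCocycle_apply γ σ
  · exact (pres_isSES ρ).f_connectingCocycle_apply γt ((pres_isSES ρ).liftCocycle_isLift γ) σ τ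
  · -- `Ψ h = H²(e⁻¹)[F]`
    rw [shaTwoConnecting_apply, ← hv, (hom_idele_isSES ρ).δ₀_apply_eq v ht hht]
    have hpush : oneCocycleClass _ ((hom_idele_isSES ρ).δ₀Cocycle ht (by rw [hht]; exact v.2)) =
        oneCocycleClass _ (IsSES.pushCocycle ξt ((dual_pres_isSES ρ).liftCocycle_isLift ξ)) := by
      rw [(dual_pres_isSES ρ).pushCocycle_liftCocycle ξ]
    rw [hpush, (dual_pres_isSES ρ).δ₁_oneCocycleClass]

/-- **The idèle `2`-cochain `B(σ,τ) = uJ (ξ̃(σ)(σ γ̃(τ))) + h̃(c(σ,τ))` exists as a CONTINUOUS map** (the hypothesis `hB` of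
`ShaTwoCochain.dTwo_bridgeCochain`): it is built in the action-free form `σ γ̃(τ) = i c(σ,τ) + γ̃(στ) − γ̃(σ)`, a continuous
function of `(σ, τ)` into a discrete product followed by a map out of a discrete space. [cite: NeukirchSchmidtWingberg2008, (1.3.2)] -/
theorem exists_bridgeCochain
    (ht : DiscreteRep.HomCarrier (LCarrier (presentationComplex ρ).X₁) (LCarrier (ideleBarD K)))
    (ξt : C(absoluteGaloisGroup K, DiscreteRep.HomCarrier (LCarrier (presentationComplex ρ).X₂) (UnitsCarrier K)))
    (γt : C(absoluteGaloisGroup K, LCarrier (presentationComplex ρ).X₂)) (c : contTwoCocycles (presModule₁ ρ).toTopRep)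
    (hc : ∀ σ τ : absoluteGaloisGroup K, presIncl ρ (c.1 (σ, τ)) = (presModule₂ ρ) σ (γt τ) - γt (σ * τ) + γt σ) :
    ∃ B : C(absoluteGaloisGroup K × absoluteGaloisGroup K, LCarrier (ideleBarD K)), ∀ σ τ : absoluteGaloisGroup K,
      B (σ, τ) = unitsToIdeleI K ((show _ →ₗ[ℤ] UnitsCarrier K from ξt σ) ((presModule₂ ρ) σ (γt τ))) +
        (show _ →ₗ[ℤ] LCarrier (ideleBarD K) from ht) (c.1 (σ, τ)) := by
  -- the continuous 4-tuple `(ξ̃ σ, c(σ,τ), γ̃(στ), γ̃ σ)` into a discrete product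
  let T : C(absoluteGaloisGroup K × absoluteGaloisGroup K,
      DiscreteRep.HomCarrier (LCarrier (presentationComplex ρ).X₂) (UnitsCarrier K) ×
        (LCarrier (presentationComplex ρ).X₁ × (LCarrier (presentationComplex ρ).X₂ × LCarrier (presentationComplex ρ).X₂))) :=
    ⟨fun q => (ξt q.1, c.1 q, γt (q.1 * q.2), γt q.1),
      (ξt.continuous.comp continuous_fst).prodMk (c.1.continuous.prodMk
        ((γt.continuous.comp (continuous_fst.mul continuous_snd)).prodMk (γt.continuous.comp continuous_fst)))⟩
  let G : DiscreteRep.HomCarrier (LCarrier (presentationComplex ρ).X₂) (UnitsCarrier K) ×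
        (LCarrier (presentationComplex ρ).X₁ × (LCarrier (presentationComplex ρ).X₂ × LCarrier (presentationComplex ρ).X₂)) →
      LCarrier (ideleBarD K) :=
    fun d => unitsToIdeleI K ((show _ →ₗ[ℤ] UnitsCarrier K from d.1) (presIncl ρ d.2.1 + d.2.2.1 - d.2.2.2)) +
      (show _ →ₗ[ℤ] LCarrier (ideleBarD K) from ht) d.2.1
  refine ⟨⟨G ∘ T, (continuous_of_discreteTopology (f := G)).comp T.continuous⟩, fun σ τ => ?_⟩
  change G (T (σ, τ)) = _
  change unitsToIdeleI K ((show _ →ₗ[ℤ] UnitsCarrier K from ξt σ) (presIncl ρ (c.1 (σ, τ)) + γt (σ * τ) - γt σ)) +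
      (show _ →ₗ[ℤ] LCarrier (ideleBarD K) from ht) (c.1 (σ, τ)) = _
  rw [hc]
  congr 3
  abel

end Summit.BirchSwinnertonDyer.BirchSwinnertonDyer.Theorems.ShaTwoCochain

end
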